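import Literature.Probability.Percolation.TriCrossingSandwich
import Literature.Probability.Percolation.TriAnnulusCrossingProofs
import Literature.Probability.Percolation.TriDualityProofs
import Literature.Probability.Percolation.OneArmLSW
import HarnessLib

/-!
# The sandwich (19) for marked discrete domains straddling the arcs

Topic `Literature/Probability/Percolation`; family `crit-perc`. Bollobás–Riordan, *Percolation*
(2006), Ch. 7, Lemma 14 (19) p. 184 with Claims 19–20 p. 192 and the remark p. 195: the open
crossing probability of a 4-marked discrete domain `G⁻` of `δ𝕋` whose sites off `Ω` hug
`A₁ ∪ A₃`, whose sites in `Ω` away from the corners keep off `A₂ ∪ A₄`, and whose first and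
third discrete arcs lie off `Ω` near `A₁`, `A₃` (away from the corners), is at most G02's
crossing probability `P_δ(Ω; A₁, A₃)` plus the probabilities of open crossings of the four corner
annuli (`openCrossingProb_le_triCrossingProb_add`); dually, `P_δ(Ω; A₁, A₃)` is at most the open
crossing probability of a domain `G⁺` hugging `A₂ ∪ A₄` plus the closed corner terms
(`triCrossingProb_le_openCrossingProb_add`, through Lemma 5, `tri_markedDomain_duality_holds`).
The corner terms are then `≤ (r₁/r₂)^α` each by Lemma 4 (`tri_annulusCrossing_bound_holds`).
The hypotheses are the pointwise conditions of `TriCrossingSandwich.lean`; they are verified for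
the marked inner approximations of the collar domains elsewhere.

## References

* B. Bollobás, O. Riordan, *Percolation*, Cambridge University Press (2006), Ch. 7 Lemma 14 (19)
  p. 184, Claims 19–20 p. 192, remark p. 195, Lemma 4 p. 166, Lemma 5 p. 169.

## Mathlib / tree

Mathlib: `SimpleGraph.Walk.takeUntil/dropUntil`, `MeasureTheory.measureReal_union_le`. Tree:
`TriCrossingSandwich` (`real_pathIn_le_triCrossingProb`, `triCrossingProb_le_real_not_pathIn`),
`TriAnnulusCrossing(Proofs)` (`triAnnulusCrossing`, `tri_annulusCrossing_bound_holds`),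
`TriDualityProofs` (`tri_markedDomain_duality_holds`), `OneArmLSW` (`PathIn.exists_walk`, `of_walk`).
-/

noncomputable section

open Set Metric MeasureTheory Literature.Probability.LatticeModels Literature.Probability.RandomPlanarGeometry

namespace Literature.Probability.Percolation

variable (R : ConformalRectangle)

/-- **Splitting a coloured walk at a corner**: a `𝕋`-walk of `c`-coloured sites from `u` to `v`
either has all its sites at distance `≥ ρ` from the four corners, or — if for each corner one of
the endpoints is at distance `> r₂` from it — it contains a monochromatic crossing of a corner
annulus `A(Pᵢ; r₁, r₂)` (`ρ ≤ r₁`). [cite: BollobasRiordan2006, Ch. 7 Claim 20 p. 192] -/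
theorem walk_far_or_annulus {δ ρ r₁ r₂ : ℝ} (hρ : ρ ≤ r₁) {c : Bool} {ω : SiteConfig (Site 2)} {u v : Site 2}
    (W : triGraph.Walk u v) (hW : ∀ x ∈ W.support, (x ∈ ω ↔ c))
    (hend : ∀ i : Fin 4, r₂ < dist (triMeshPoint δ u) (R.pt i) ∨ r₂ < dist (triMeshPoint δ v) (R.pt i)) :
    (∀ x ∈ W.support, ∀ i : Fin 4, ρ ≤ dist (triMeshPoint δ x) (R.pt i)) ∨
      ∃ i : Fin 4, ω ∈ triAnnulusCrossing c δ (R.pt i) r₁ r₂ := by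
  classical
  by_cases hfar : ∀ x ∈ W.support, ∀ i : Fin 4, ρ ≤ dist (triMeshPoint δ x) (R.pt i)
  · exact Or.inl hfar
  push Not at hfar
  obtain ⟨x, hx, i, hxi⟩ := hfar
  refine Or.inr ⟨i, ?_⟩
  have hxi' : ‖triMeshPoint δ x - R.pt i‖ < r₁ := by rw [← dist_eq_norm]; exact hxi.trans_le hρ
  rcases hend i with hu | hv
  · refine ⟨x, u, (W.takeUntil x hx).reverse, hxi', by rwa [← dist_eq_norm], fun y hy => hW y (W.support_takeUntil_subset_support hx ?_)⟩
    rwa [SimpleGraph.Walk.support_reverse, List.mem_reverse] at hy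
  · exact ⟨x, v, W.dropUntil x hx, hxi', by rwa [← dist_eq_norm], fun y hy => hW y (W.support_dropUntil_subset_support hx hy)⟩

/-- **Lower half of (19) with corner terms.** Let `G` be a 4-marked discrete domain placed in `δ𝕋`
such that: sites off `Ω` are within `t` of `A₁ ∪ A₃` (arcs `0`, `2`); sites in `Ω` at distance
`≥ ρ` from the corners are farther than `δ` from `A₂ ∪ A₄`; sites of the discrete arcs `0`, `2`
at distance `≥ ρ` from the corners are off `Ω` and within `t` of `A₁`, resp. `A₃`; and sites of
the discrete arc `0` (resp. `2`) are at distance `> r₂` from `P₂, P₃` (resp. `P₀, P₁`). Then, for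
`δ`, `t` below the thresholds of `real_pathIn_le_triCrossingProb` and `ρ ≤ r₁`,
`P(G has an open crossing from arc 0 to arc 2) ≤ P_δ(Ω; A₁, A₃) + Σᵢ P(A(Pᵢ; r₁, r₂) has an open crossing)`.
[cite: BollobasRiordan2006, Ch. 7 Lemma 14 (19), Claims 19–20 p. 192, p. 195] -/
theorem openCrossingProb_le_triCrossingProb_add :
    ∃ δ₀ > 0, ∃ t₀ > 0, ∀ δ t : ℝ, 0 < δ → δ < δ₀ → 0 ≤ t → t ≤ t₀ → ∀ {ρ r₁ r₂ : ℝ}, ρ ≤ r₁ →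
      ∀ G : TriMarkedDomain 4,
        (∀ x ∈ G.verts, triMeshPoint δ x ∉ R.carrier →
          infDist (triMeshPoint δ x) (R.arc 0) ≤ t ∨ infDist (triMeshPoint δ x) (R.arc 2) ≤ t) →
        (∀ x ∈ G.verts, triMeshPoint δ x ∈ R.carrier → (∀ i, ρ ≤ dist (triMeshPoint δ x) (R.pt i)) →
          δ < infDist (triMeshPoint δ x) (R.arc 1) ∧ δ < infDist (triMeshPoint δ x) (R.arc 3)) →
        (∀ u ∈ G.arc 0, (∀ i, ρ ≤ dist (triMeshPoint δ u) (R.pt i)) →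
          triMeshPoint δ u ∉ R.carrier ∧ infDist (triMeshPoint δ u) (R.arc 0) ≤ t) →
        (∀ v ∈ G.arc 2, (∀ i, ρ ≤ dist (triMeshPoint δ v) (R.pt i)) →
          triMeshPoint δ v ∉ R.carrier ∧ infDist (triMeshPoint δ v) (R.arc 2) ≤ t) →
        (∀ u ∈ G.arc 0, r₂ < dist (triMeshPoint δ u) (R.pt 2) ∧ r₂ < dist (triMeshPoint δ u) (R.pt 3)) →
        (∀ v ∈ G.arc 2, r₂ < dist (triMeshPoint δ v) (R.pt 0) ∧ r₂ < dist (triMeshPoint δ v) (R.pt 1)) →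
        G.openCrossingProb 0 2 ≤ triCrossingProb R.carrier δ (R.arc 0) (R.arc 2) half +
          ∑ i : Fin 4, (triSitePercolation half).real (triAnnulusCrossing true δ (R.pt i) r₁ r₂) := by
  classical
  obtain ⟨δ₀, hδ₀, t₀, ht₀, hsand⟩ := real_pathIn_le_triCrossingProb R
  refine ⟨δ₀, hδ₀, t₀, ht₀, fun δ t hδ hδlt ht htle ρ r₁ r₂ hρ G hout hin hU₀ hU₂ hfar0 hfar2 => ?_⟩
  -- the corner-avoiding sites and arcs
  set V : Set (Site 2) := {x | x ∈ G.verts ∧ ∀ i, ρ ≤ dist (triMeshPoint δ x) (R.pt i)} with hV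
  set U₀ : Set (Site 2) := {u | u ∈ G.arc 0 ∧ ∀ i, ρ ≤ dist (triMeshPoint δ u) (R.pt i)} with hU₀def
  set U₂ : Set (Site 2) := {v | v ∈ G.arc 2 ∧ ∀ i, ρ ≤ dist (triMeshPoint δ v) (R.pt i)} with hU₂def
  have hle := hsand δ t hδ hδlt ht htle half V U₀ U₂ (fun x hx => hout x hx.1) (fun x hx hxΩ => hin x hx.1 hxΩ hx.2)
    (fun u hu => hU₀ u hu.1 hu.2) (fun v hv => hU₂ v hv.1 hv.2)
  -- event inclusion
  have hsub : G.openCrossing 0 2 ⊆ {ω | ∃ u ∈ U₀, ∃ v ∈ U₂, PathIn triGraph (V ∩ ω) u v} ∪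
      ⋃ i : Fin 4, triAnnulusCrossing true δ (R.pt i) r₁ r₂ := by
    rintro ω ⟨u, hu, v, hv, hP⟩
    obtain ⟨W, hW⟩ := hP.exists_walk
    have hend : ∀ i : Fin 4, r₂ < dist (triMeshPoint δ u) (R.pt i) ∨ r₂ < dist (triMeshPoint δ v) (R.pt i) := by
      intro i
      match i with
      | 0 => exact Or.inr (hfar2 v hv).1
      | 1 => exact Or.inr (hfar2 v hv).2
      | 2 => exact Or.inl (hfar0 u hu).1
      | 3 => exact Or.inl (hfar0 u hu).2
    rcases walk_far_or_annulus R hρ (c := true) (ω := ω) W (fun x hx => by simpa using (hW x hx).2) hend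
      with hfar | ⟨i, hi⟩
    · refine Or.inl ⟨u, ⟨hu, hfar u W.start_mem_support⟩, v, ⟨hv, hfar v W.end_mem_support⟩, ?_⟩
      exact PathIn.of_walk W fun x hx => ⟨⟨(hW x hx).1, hfar x hx⟩, (hW x hx).2⟩
    · exact Or.inr (mem_iUnion.2 ⟨i, hi⟩)
  calc G.openCrossingProb 0 2 = (triSitePercolation half).real (G.openCrossing 0 2) := rfl
    _ ≤ (triSitePercolation half).real ({ω | ∃ u ∈ U₀, ∃ v ∈ U₂, PathIn triGraph (V ∩ ω) u v} ∪
          ⋃ i : Fin 4, triAnnulusCrossing true δ (R.pt i) r₁ r₂) := measureReal_mono hsub (measure_ne_top _ _)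
    _ ≤ (triSitePercolation half).real {ω | ∃ u ∈ U₀, ∃ v ∈ U₂, PathIn triGraph (V ∩ ω) u v} +
          (triSitePercolation half).real (⋃ i : Fin 4, triAnnulusCrossing true δ (R.pt i) r₁ r₂) := measureReal_union_le _ _
    _ ≤ triCrossingProb R.carrier δ (R.arc 0) (R.arc 2) half +
          ∑ i : Fin 4, (triSitePercolation half).real (triAnnulusCrossing true δ (R.pt i) r₁ r₂) := by
        gcongr
        exact measureReal_iUnion_fintype_le _

/-- **Upper half of (19) with corner terms.** Let `G` be a 4-marked discrete domain placed in `δ𝕋`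
such that: sites off `Ω` are within `t` of `A₂ ∪ A₄` (arcs `1`, `3`); sites in `Ω` at distance
`≥ ρ` from the corners are farther than `δ` from `A₁ ∪ A₃`; sites of the discrete arcs `1`, `3` at
distance `≥ ρ` from the corners are off `Ω` and within `t` of `A₂`, resp. `A₄`; and sites of the
discrete arc `1` (resp. `3`) are at distance `> r₂` from `P₃, P₀` (resp. `P₁, P₂`). Then, for
`δ`, `t` below the thresholds of `triCrossingProb_le_real_not_pathIn` (at corner radius `ρ`) and
`ρ ≤ r₁`, `P_δ(Ω; A₁, A₃) ≤ P(G has an open crossing from arc 0 to arc 2) + Σᵢ P(A(Pᵢ; r₁, r₂) has a closed crossing)`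
(Lemma 5: no closed crossing from arc `1` to arc `3` forces an open one from arc `0` to arc `2`).
[cite: BollobasRiordan2006, Ch. 7 Lemma 14 (19), Claims 19–20 p. 192, p. 195, Lemma 5] -/
theorem triCrossingProb_le_openCrossingProb_add {ρ : ℝ} (hρ0 : 0 < ρ) :
    ∃ δ₀ > 0, ∃ t₀ > 0, ∀ δ t : ℝ, 0 < δ → δ < δ₀ → 0 ≤ t → t ≤ t₀ → ∀ {r₁ r₂ : ℝ}, ρ ≤ r₁ →
      ∀ G : TriMarkedDomain 4,
        (∀ x ∈ G.verts, triMeshPoint δ x ∉ R.carrier →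
          infDist (triMeshPoint δ x) (R.arc 1) ≤ t ∨ infDist (triMeshPoint δ x) (R.arc 3) ≤ t) →
        (∀ x ∈ G.verts, triMeshPoint δ x ∈ R.carrier → (∀ i, ρ ≤ dist (triMeshPoint δ x) (R.pt i)) →
          δ < infDist (triMeshPoint δ x) (R.arc 0) ∧ δ < infDist (triMeshPoint δ x) (R.arc 2)) →
        (∀ u ∈ G.arc 1, (∀ i, ρ ≤ dist (triMeshPoint δ u) (R.pt i)) →
          triMeshPoint δ u ∉ R.carrier ∧ infDist (triMeshPoint δ u) (R.arc 1) ≤ t) →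
        (∀ v ∈ G.arc 3, (∀ i, ρ ≤ dist (triMeshPoint δ v) (R.pt i)) →
          triMeshPoint δ v ∉ R.carrier ∧ infDist (triMeshPoint δ v) (R.arc 3) ≤ t) →
        (∀ u ∈ G.arc 1, r₂ < dist (triMeshPoint δ u) (R.pt 3) ∧ r₂ < dist (triMeshPoint δ u) (R.pt 0)) →
        (∀ v ∈ G.arc 3, r₂ < dist (triMeshPoint δ v) (R.pt 1) ∧ r₂ < dist (triMeshPoint δ v) (R.pt 2)) →
        triCrossingProb R.carrier δ (R.arc 0) (R.arc 2) half ≤ G.openCrossingProb 0 2 +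
          ∑ i : Fin 4, (triSitePercolation half).real (triAnnulusCrossing false δ (R.pt i) r₁ r₂) := by
  classical
  obtain ⟨δ₀, hδ₀, t₀, ht₀, hsand⟩ := triCrossingProb_le_real_not_pathIn R hρ0
  refine ⟨δ₀, hδ₀, t₀, ht₀, fun δ t hδ hδlt ht htle r₁ r₂ hρ G hout hin hU₁ hU₃ hfar1 hfar3 => ?_⟩
  set V : Set (Site 2) := {x | x ∈ G.verts ∧ ∀ i, ρ ≤ dist (triMeshPoint δ x) (R.pt i)} with hV
  set U₁ : Set (Site 2) := {u | u ∈ G.arc 1 ∧ ∀ i, ρ ≤ dist (triMeshPoint δ u) (R.pt i)} with hU₁def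
  set U₃ : Set (Site 2) := {v | v ∈ G.arc 3 ∧ ∀ i, ρ ≤ dist (triMeshPoint δ v) (R.pt i)} with hU₃def
  have hle := hsand δ t hδ hδlt ht htle half V U₁ U₃ (fun x hx => hout x hx.1) (fun x hx hxΩ => hin x hx.1 hxΩ hx.2)
    (fun x hx hxΩ j => hx.2 j) (fun u hu => hU₁ u hu.1 hu.2) (fun v hv => hU₃ v hv.1 hv.2)
  -- event inclusion: no corner-avoiding closed path from `U₁` to `U₃` ⟹ open crossing of `G` from
  -- arc 0 to arc 2, or a closed corner crossing
  have hsub : {ω : SiteConfig (Site 2) | ¬ ∃ u ∈ U₁, ∃ v ∈ U₃, PathIn triGraph (V ∩ ωᶜ) u v} ⊆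
      G.openCrossing 0 2 ∪ ⋃ i : Fin 4, triAnnulusCrossing false δ (R.pt i) r₁ r₂ := by
    intro ω hω
    by_cases hcl : G.IsClosedCrossing ω 1 3
    · obtain ⟨u, hu, v, hv, hP⟩ := hcl
      obtain ⟨W, hW⟩ := hP.exists_walk
      -- a closed walk from arc 1 to arc 3: `u` is far from `P₃, P₀`, `v` is far from `P₁, P₂`
      have hend : ∀ i : Fin 4, r₂ < dist (triMeshPoint δ u) (R.pt i) ∨ r₂ < dist (triMeshPoint δ v) (R.pt i) := by
        intro i
        match i with
        | 0 => exact Or.inl (hfar1 u hu).2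
        | 1 => exact Or.inr (hfar3 v hv).1
        | 2 => exact Or.inr (hfar3 v hv).2
        | 3 => exact Or.inl (hfar1 u hu).1
      rcases walk_far_or_annulus R hρ (c := false) (ω := ω) W (fun x hx => by simpa using (hW x hx).2) hend
        with hfar | ⟨i, hi⟩
      · exfalso
        refine hω ⟨u, ⟨hu, fun i => hfar u W.start_mem_support i⟩, v, ⟨hv, fun i => hfar v W.end_mem_support i⟩, ?_⟩
        exact PathIn.of_walk W fun x hx => ⟨⟨(hW x hx).1, fun i => hfar x hx i⟩, (hW x hx).2⟩
      · exact Or.inr (mem_iUnion.2 ⟨i, hi⟩)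
    · exact Or.inl (((tri_markedDomain_duality_holds G ω).or).resolve_right hcl)
  calc triCrossingProb R.carrier δ (R.arc 0) (R.arc 2) half
      ≤ (triSitePercolation half).real {ω | ¬ ∃ u ∈ U₁, ∃ v ∈ U₃, PathIn triGraph (V ∩ ωᶜ) u v} := hle
    _ ≤ (triSitePercolation half).real (G.openCrossing 0 2 ∪ ⋃ i : Fin 4, triAnnulusCrossing false δ (R.pt i) r₁ r₂) :=
        measureReal_mono hsub (measure_ne_top _ _)
    _ ≤ (triSitePercolation half).real (G.openCrossing 0 2) +
          (triSitePercolation half).real (⋃ i : Fin 4, triAnnulusCrossing false δ (R.pt i) r₁ r₂) := measureReal_union_le _ _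
    _ ≤ G.openCrossingProb 0 2 + ∑ i : Fin 4, (triSitePercolation half).real (triAnnulusCrossing false δ (R.pt i) r₁ r₂) := by
        gcongr
        · exact le_rfl
        · exact measureReal_iUnion_fintype_le _

end Literature.Probability.Percolation
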